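import Summits.BirchSwinnertonDyer.BirchSwinnertonDyer.Theorems.EisensteinPrimesResidualDevissageFiniteKernel
import Summits.BirchSwinnertonDyer.BirchSwinnertonDyer.Theorems.EisensteinPrimesCharResidualSelmerKummer
import HarnessLib

/-!
# The unramified classes `U(A) = {c ∈ H¹(H, A) : unramified outside S₀ ∪ {p}}` under equivariant maps: transport,
# reflection, Kummer surjectivity onto `U(A)[p]`, and exactness of the residual sequence on the `U`'s
# (cell `bsd-eis`, seat `bsd-line-x1-p1` LEAD g4; crux 2 `GoodLatticeBDPValue` stmt-BirchSwinnertonDyer-19032, line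
# `halves`, V21 index road §3 (I9) / §4 plumbing (v))

HONEST FRAMING (cell `bsd-eis`, run/shared/lean/pub/bsd-eis/): Galois-cohomology bookkeeping (no definition, no named fact,
no `sorry`, no `Theses` import); nothing about any curve is asserted; BSD / IMC2 / KY Thm. 1.4.1 are proved for NO curve.
Helper `--supports stmt-BirchSwinnertonDyer-19032`; closes no registered stub.

## What

`H ≤ Γ_K` normal (`H = Gal(K̄/K_∞)`), `U(M) := GreenbergVatsal2000.unramifiedOutside H M p S₀ ≤ H¹(H, M)` (the classes
unramified, at every conjugate, outside `S₀ ∪ {w ∣ p}` — the tree's `H¹(K_Σ/K_∞, M)`). For a `Γ_K`-equivariant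
`ψ : M → M'` whose `ψ_*` is injective on `H¹(H ⊓ I_v, ·)` for the good `v` (hypothesis (U), as in x2-p2's p633072; true
when inertia acts trivially on a divisible `M'`, `resH1Hom_id_injective_of_invariants_divisible`):
* `mem_unramifiedOutside_iff_resH1Hom_mem` — `c ∈ U(M) ↔ ψ_* c ∈ U(M')`; `ker_resH1Hom_le_unramifiedOutside` — `ker ψ_* ≤ U(M)`.
* `exists_mem_unramifiedOutside_resH1Hom_eq_of_nsmul_eq_zero` — KUMMER ONTO `U(B)[p]`: for `j : A ↪ B` onto `B[p]`, `B`
  `p`-divisible, every `u ∈ U(B)` with `p u = 0` is `j_* c` with `c ∈ U(A)` (w4 gen 3's `exists_resH1Hom_id_eq_of_nsmul_eq_zero` + reflection).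
* `exists_mem_unramifiedOutside_resH1Hom_eq_of_resH1Hom_eq_zero` — EXACTNESS ON THE `U`'s: along `0 → A —i→ B —π→ C → 0`,
  `x ∈ U(B)` with `π_* x = 0` is `i_* y` with `y ∈ U(A)` (tree `exists_resH1Hom_eq_of_resH1Hom_eq_zero` + reflection for `i`).
* `resOfLe_conjH1_resH1Hom` — the signature maps `x ↦ (res_{H ⊓ D_𝔭} conj_{τ i} x)_i` commute with `ψ_*`.

References: [GreenbergVatsal2000] §2 pp. 16–17; [SerreGaloisCohomology1997] I §2.2; [KellerYin2024] Lemma 1.2.4 (arXiv:2402.12781v2);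
tree p633072 (x2-p2), p639745 (w4 gen 3), `UniversalToricDescentResidualSelmerTransport`.
-/

set_option autoImplicit false
set_option linter.dupNamespace false -- the summit namespace `…BirchSwinnertonDyer.BirchSwinnertonDyer.Theorems` (Sub = Summit, D-0017) trips it

noncomputable section

open scoped Classical AddSubgroup

namespace Summit.BirchSwinnertonDyer.BirchSwinnertonDyer.Theorems.ResidualIndexUnramified

open Function NumberField IsDedekindDomain Field
open Literature.NumberTheory.EllipticCurves Literature.NumberTheory.EllipticCurves.GreenbergSelmer
  Literature.NumberTheory.EllipticCurves.GreenbergVatsal2000 Literature.NumberTheory.GaloisRepresentations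
  Literature.NumberTheory.EllipticCurves.FineSelmerCoefficientMap
  Summit.BirchSwinnertonDyer.BirchSwinnertonDyer.Theorems.UniversalToricDescentResidualSelmer
  Summit.BirchSwinnertonDyer.BirchSwinnertonDyer.Theorems.CumulativeHeegnerInclusionAtThreeStubB1Devissage
  Summit.BirchSwinnertonDyer.BirchSwinnertonDyer.Theorems.CharResidualSelmerCount

variable {K : Type} [Field K] [NumberField K] (H : Subgroup (absoluteGaloisGroup K)) [H.Normal] (p : ℕ)
  (S₀ : Set (HeightOneSpectrum (𝓞 K)))

variable {M : Type} [AddCommGroup M] [DistribMulAction (absoluteGaloisGroup K) M] [TopologicalSpace M]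
  [DiscreteTopology M]
variable {M' : Type} [AddCommGroup M'] [DistribMulAction (absoluteGaloisGroup K) M'] [TopologicalSpace M']
  [DiscreteTopology M']
variable {M'' : Type} [AddCommGroup M''] [DistribMulAction (absoluteGaloisGroup K) M''] [TopologicalSpace M'']
  [DiscreteTopology M'']

/-! ## §1 Transport and reflection of the unramified conditions along `ψ_*` -/

/-- `ψ_*` maps `U(M)` into `U(M')` (naturality of `conj_σ` and of the restriction to inertia).
[cite: GreenbergVatsal2000, §2 p. 17] -/
theorem resH1Hom_mem_unramifiedOutside (ψ : M →+ M')
    (hψ : ∀ (g : absoluteGaloisGroup K) (m : M), ψ (g • m) = g • ψ m) {c : subgroupH1 H M}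
    (hc : c ∈ unramifiedOutside H M p S₀) :
    resH1Hom (ContinuousMonoidHom.id H) ψ (fun g m ↦ hψ (g : absoluteGaloisGroup K) m) c ∈
      unramifiedOutside H M' p S₀ := by
  rw [mem_unramifiedOutside_iff] at hc ⊢
  intro v hvS hvp σ
  have hconj := congrArg (fun f : subgroupH1 H M →+ subgroupH1 H M' ↦ f c)
    (conjH1_comp_resH1Hom_id H ψ (fun g m ↦ hψ (g : absoluteGaloisGroup K) m) hψ σ)
  simp only [AddMonoidHom.comp_apply] at hconj
  rw [hconj]
  exact resH1Hom_id_mem_unramifiedKer H v ψ hψ _ (hc v hvS hvp σ)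

/-- **Reflection**: if `ψ_*` is injective on `H¹(H ⊓ I_v, ·)` for every good `v ∉ S₀` (hypothesis (U)), then
`c ∈ U(M) ↔ ψ_* c ∈ U(M')`. [cite: KellerYin2024, Lemma 1.2.4 (arXiv:2402.12781v2 TeX L760–778)] -/
theorem mem_unramifiedOutside_iff_resH1Hom_mem (ψ : M →+ M')
    (hψ : ∀ (g : absoluteGaloisGroup K) (m : M), ψ (g • m) = g • ψ m)
    (hU : ∀ v : HeightOneSpectrum (𝓞 K), v ∉ S₀ → ((p : ℕ) : 𝓞 K) ∉ v.asIdeal →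
      Injective (resH1Hom (ContinuousMonoidHom.id (inertiaIn H v)) ψ
        (fun g m ↦ hψ ((g : decomp (K := K) v) : absoluteGaloisGroup K) m)))
    (c : subgroupH1 H M) :
    c ∈ unramifiedOutside H M p S₀ ↔
      resH1Hom (ContinuousMonoidHom.id H) ψ (fun g m ↦ hψ (g : absoluteGaloisGroup K) m) c ∈
        unramifiedOutside H M' p S₀ := by
  refine ⟨resH1Hom_mem_unramifiedOutside H p S₀ ψ hψ, fun hc ↦ ?_⟩
  rw [mem_unramifiedOutside_iff] at hc ⊢
  intro v hvS hvp σ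
  have h := hc v hvS hvp σ
  have hconj := congrArg (fun f : subgroupH1 H M →+ subgroupH1 H M' ↦ f c)
    (conjH1_comp_resH1Hom_id H ψ (fun g m ↦ hψ (g : absoluteGaloisGroup K) m) hψ σ)
  simp only [AddMonoidHom.comp_apply] at hconj
  rw [hconj, GreenbergVatsal2000.unramifiedKer, AddMonoidHom.mem_ker] at h
  rw [GreenbergVatsal2000.unramifiedKer, AddMonoidHom.mem_ker]
  have e := congrArg (fun f ↦ f (conjH1 H M σ c)) (res_inertiaIn_comp_resH1Hom_id H v ψ
    (fun g m ↦ hψ (g : absoluteGaloisGroup K) m)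
    (fun g m ↦ hψ ((g : decomp (K := K) v) : absoluteGaloisGroup K) m))
  simp only [AddMonoidHom.comp_apply] at e
  rw [e] at h
  exact (injective_iff_map_eq_zero _).mp (hU v hvS hvp) _ h

/-- `ker ψ_* ≤ U(M)` under (U). [cite: GreenbergVatsal2000, §2 p. 17] -/
theorem ker_resH1Hom_le_unramifiedOutside (ψ : M →+ M')
    (hψ : ∀ (g : absoluteGaloisGroup K) (m : M), ψ (g • m) = g • ψ m)
    (hU : ∀ v : HeightOneSpectrum (𝓞 K), v ∉ S₀ → ((p : ℕ) : 𝓞 K) ∉ v.asIdeal →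
      Injective (resH1Hom (ContinuousMonoidHom.id (inertiaIn H v)) ψ
        (fun g m ↦ hψ ((g : decomp (K := K) v) : absoluteGaloisGroup K) m))) :
    (resH1Hom (ContinuousMonoidHom.id H) ψ (fun g m ↦ hψ (g : absoluteGaloisGroup K) m)).ker ≤
      unramifiedOutside H M p S₀ := by
  intro c hc
  rw [mem_unramifiedOutside_iff_resH1Hom_mem H p S₀ ψ hψ hU, (AddMonoidHom.mem_ker).1 hc]
  exact zero_mem _

/-! ## §2 Kummer surjectivity onto `U(B)[p]` and exactness on the `U`'s -/

/-- **Kummer onto `U(B)[p]`.** `j : A ↪ B` equivariant onto `B[p]`, `B` `p`-divisible with continuous orbit maps, and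
(U) for `j`: every `u ∈ U(B)` with `p u = 0` is `j_* c` for some `c ∈ U(A)`.
[cite: KellerYin2024, Lemma 1.2.4 (arXiv:2402.12781v2 TeX L728–744)] [cite: SerreGaloisCohomology1997, I §2.2] -/
theorem exists_mem_unramifiedOutside_resH1Hom_eq_of_nsmul_eq_zero (j : M →+ M')
    (hj : ∀ (g : absoluteGaloisGroup K) (a : M), j (g • a) = g • j a) (hinj : Injective j)
    (hrange : ∀ x : M', x ∈ j.range ↔ p • x = 0) (hdiv : ∀ b : M', ∃ b' : M', p • b' = b)
    (hcont : ∀ b : M', Continuous fun g : absoluteGaloisGroup K ↦ g • b)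
    (hU : ∀ v : HeightOneSpectrum (𝓞 K), v ∉ S₀ → ((p : ℕ) : 𝓞 K) ∉ v.asIdeal →
      Injective (resH1Hom (ContinuousMonoidHom.id (inertiaIn H v)) j
        (fun g m ↦ hj ((g : decomp (K := K) v) : absoluteGaloisGroup K) m)))
    {u : subgroupH1 H M'} (hu : u ∈ unramifiedOutside H M' p S₀) (hpu : p • u = 0) :
    ∃ c ∈ unramifiedOutside H M p S₀,
      resH1Hom (ContinuousMonoidHom.id H) j (fun g m ↦ hj (g : absoluteGaloisGroup K) m) c = u := by
  have hcontH : ∀ b : M', Continuous fun g : H ↦ g • b := fun b ↦ (hcont b).comp continuous_subtype_val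
  obtain ⟨c, hc⟩ := exists_resH1Hom_id_eq_of_nsmul_eq_zero (G := H) j
    (fun g m ↦ hj (g : absoluteGaloisGroup K) m) hinj hrange hcontH hdiv u hpu
  refine ⟨c, ?_, hc⟩
  rw [mem_unramifiedOutside_iff_resH1Hom_mem H p S₀ j hj hU, hc]
  exact hu

/-- **Exactness on the `U`'s.** Along an exact `0 → A —i→ B —π→ C → 0` of discrete `Γ_K`-modules with continuous orbits
and (U) for `i`: `x ∈ U(B)` with `π_* x = 0` is `i_* y` with `y ∈ U(A)`. [cite: SerreGaloisCohomology1997, I §2.2] -/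
theorem exists_mem_unramifiedOutside_resH1Hom_eq_of_resH1Hom_eq_zero (i : M →+ M') (π : M' →+ M'')
    (hi : ∀ (g : absoluteGaloisGroup K) (a : M), i (g • a) = g • i a) (hinj : Injective i)
    (hπ : ∀ (g : absoluteGaloisGroup K) (b : M'), π (g • b) = g • π b) (hsurj : Surjective π)
    (hexact : ∀ b : M', π b = 0 → ∃ a : M, i a = b)
    (hcont : ∀ b : M', Continuous fun g : absoluteGaloisGroup K ↦ g • b)
    (hU : ∀ v : HeightOneSpectrum (𝓞 K), v ∉ S₀ → ((p : ℕ) : 𝓞 K) ∉ v.asIdeal →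
      Injective (resH1Hom (ContinuousMonoidHom.id (inertiaIn H v)) i
        (fun g m ↦ hi ((g : decomp (K := K) v) : absoluteGaloisGroup K) m)))
    {x : subgroupH1 H M'} (hx : x ∈ unramifiedOutside H M' p S₀)
    (hπx : resH1Hom (ContinuousMonoidHom.id H) π (fun g b ↦ hπ (g : absoluteGaloisGroup K) b) x = 0) :
    ∃ y ∈ unramifiedOutside H M p S₀,
      resH1Hom (ContinuousMonoidHom.id H) i (fun g a ↦ hi (g : absoluteGaloisGroup K) a) y = x := by
  have hcontH : ∀ b : M', Continuous fun g : H ↦ g • b := fun b ↦ (hcont b).comp continuous_subtype_val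
  obtain ⟨y, hy⟩ := exists_resH1Hom_eq_of_resH1Hom_eq_zero (G := H) i
    (fun g a ↦ hi (g : absoluteGaloisGroup K) a) hinj π (fun g b ↦ hπ (g : absoluteGaloisGroup K) b) hsurj hexact
    hcontH hπx
  refine ⟨y, ?_, hy⟩
  rw [mem_unramifiedOutside_iff_resH1Hom_mem H p S₀ i hi hU, hy]
  exact hx

/-! ## §3 The signature maps commute with `ψ_*` -/

/-- `res_{H ⊓ D_𝔭} (conj_σ (ψ_* x)) = ψ_* (res_{H ⊓ D_𝔭} (conj_σ x))` (naturality of conjugation and restriction).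
[cite: SerreGaloisCohomology1997, I §2.4–2.5] -/
theorem resOfLe_conjH1_resH1Hom (𝔭 : HeightOneSpectrum (𝓞 K)) (ψ : M →+ M')
    (hψ : ∀ (g : absoluteGaloisGroup K) (m : M), ψ (g • m) = g • ψ m) (σ : absoluteGaloisGroup K)
    (x : subgroupH1 H M) :
    resOfLe M' (inf_le_left : H ⊓ decomp 𝔭 ≤ H)
        (conjH1 H M' σ (resH1Hom (ContinuousMonoidHom.id H) ψ (fun g m ↦ hψ (g : absoluteGaloisGroup K) m) x)) =
      resH1Hom (ContinuousMonoidHom.id ↥(H ⊓ decomp 𝔭)) ψ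
          (fun g m ↦ hψ (g : absoluteGaloisGroup K) m)
        (resOfLe M (inf_le_left : H ⊓ decomp 𝔭 ≤ H) (conjH1 H M σ x)) := by
  have hconj := congrArg (fun f : subgroupH1 H M →+ subgroupH1 H M' ↦ f x)
    (conjH1_comp_resH1Hom_id H ψ (fun g m ↦ hψ (g : absoluteGaloisGroup K) m) hψ σ)
  simp only [AddMonoidHom.comp_apply] at hconj
  rw [hconj]
  have e := congrArg (fun f : subgroupH1 H M →+ subgroupH1 (H ⊓ decomp 𝔭) M' ↦ f (conjH1 H M σ x))
    (resOfLe_comp_resH1Hom_id (inf_le_left : H ⊓ decomp 𝔭 ≤ H) ψ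
      (fun g m ↦ hψ (g : absoluteGaloisGroup K) m) (fun g m ↦ hψ (g : absoluteGaloisGroup K) m))
  simpa only [AddMonoidHom.comp_apply] using e

end Summit.BirchSwinnertonDyer.BirchSwinnertonDyer.Theorems.ResidualIndexUnramified

end
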